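import Summits.KontsevichZagierPeriods.KontsevichZagierPeriods.Theses.Grothendieck
import Summits.KontsevichZagierPeriods.KontsevichZagierPeriods.Theorems.GpcZeta4Eq4zeta31.Negative.Core
import Summits.KontsevichZagierPeriods.KontsevichZagierPeriods.Theorems.GpcLegendreLemniscatic.Negative.Canonical
import Literature.NumberTheory.Transcendental.KZKernelConjectureForms
import Literature.NumberTheory.Transcendental.KZRulesAssociator
import Literature.NumberTheory.Transcendental.KZCalculusProofs

/-!
# KontsevichZagierPeriods / SectorComplement — negative core (crux stmt-KontsevichZagierPeriods-11102)

Problem `KontsevichZagierPeriods`, route Grothendieck, crux `SectorComplement :=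
LemniscaticSectorKernel → GpcZeta4Eq4zeta31 → KontsevichZagierPeriods` (the declared summit-strength
remainder of the route, auto-promoted to a crux 2026-08-16). Negative lemmas extracted from the standing
disprover's work file `Cruxes/SectorComplement/Disproof.lean` (refuter-cdisprove-…-11102-0, cycle 1);
theorems only, every conclusion a negation or free of route items (the `↔`-characterisations
`SectorComplement ↔ ((H₁ ∧ H₂) ↔ summit)`, `¬SectorComplement ↔ H₁ ∧ H₂ ∧ ¬summit` stay in the work file):

* §1 ANATOMY OF A REFUTATION. Both antecedents are summit-consequences (`not_summit_of_not_h1`,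
  `not_summit_of_not_h2`), so a refutation of the crux refutes the summit (`not_summit_of_not_crux`) and is
  incompatible with a refutation of either sector statement (`not_not_h1_of_not_crux`,
  `not_not_h2_of_not_crux`); conversely both sectors plus `¬summit` refute the crux
  (`not_crux_of_sectors_of_not_summit`). A kill of this crux = proofs of BOTH open sector cruxes + a
  disproof of Conjecture 1 as formalised.
* §2 THE ONLY WEAPON, as a template: `not_summit_of_separating_invariant` /
  `not_crux_of_separating_invariant` (an additive invariant of `FormalRep` vanishing on the four move sets
  and non-zero on a kernel element) and the converse `exists_separating_of_not_summit`. (Companion file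
  `Negative/Invariants.lean`: no such invariant with finitely generated values exists.)
* §3 REFUTED STRENGTHENING: the summit without its value hypothesis is false
  (`not_summitWithoutValueEq`, witness `[∅]` vs `[ℝ⁰, 1]`), so the crux with that conclusion fails as soon
  as the sectors hold (`not_cruxStrong_of_sectors`). (The kernel form without `eval c = 0` is refuted in
  the tree: `ReducedPeriodRingNegative.reducedPeriodRing_false_without_sq`.)
* §4 given `H₁ ∧ H₂`, a refutation of this route's crux 0280 already refutes the crux
  (`not_crux_of_not_gpcLegendre`).

[Kontsevich–Zagier 2001, §1.2, Conjecture 1; Huber–Müller-Stach 2017, §13.2]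
-/

noncomputable section

namespace Summit.KontsevichZagierPeriods.SectorComplement.Negative

open Set MeasureTheory
open Literature.NumberTheory.Transcendental
open Literature.NumberTheory.Transcendental.KZ
open Summit.KontsevichZagierPeriods.KontsevichZagierPeriods.Theses.Grothendieck
  (SectorComplement LemniscaticSectorKernel GpcZeta4Eq4zeta31 GpcLegendreLemniscatic)

/-! ## §1 Anatomy of a refutation -/

/-- A refutation of the sector kernel `H₁` refutes the summit: `H₁` is an instance of the kernel form
`ker eval = relations`, which IS the summit (tree theorem `kzKernelConjecture_iff_isRational`); the
domain / integrand hypotheses of `H₁` are not even used. [folklore] -/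
theorem not_summit_of_not_h1 (h : ¬ LemniscaticSectorKernel) : ¬ KontsevichZagierPeriods := fun hs =>
  h fun _ _ _ _ _ _ _ _ _ h0 => (kzKernelConjecture_iff_isRational.mpr hs) _ h0

/-- A refutation of the weight-4 probe `H₂` refutes the summit (sibling seat, landed:
`GpcZeta4Eq4zeta31.Negative.not_summit_of_not_crux`). [folklore] -/
theorem not_summit_of_not_h2 (h : ¬ GpcZeta4Eq4zeta31) : ¬ KontsevichZagierPeriods :=
  Summit.KontsevichZagierPeriods.GpcZeta4Eq4zeta31.Negative.not_summit_of_not_crux h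

/-- **A refutation of the crux refutes the summit** (the summit proves the crux by discarding the
antecedents). [folklore] -/
theorem not_summit_of_not_crux (h : ¬ SectorComplement) : ¬ KontsevichZagierPeriods :=
  fun hs => h fun _ _ => hs

/-- A refutation of the crux is incompatible with a refutation of `H₁` (the crux holds vacuously when
`H₁` fails). [folklore] -/
theorem not_not_h1_of_not_crux (h : ¬ SectorComplement) : ¬ ¬ LemniscaticSectorKernel :=
  fun h1 => h fun h1' _ => absurd h1' h1

/-- A refutation of the crux is incompatible with a refutation of `H₂`. [folklore] -/
theorem not_not_h2_of_not_crux (h : ¬ SectorComplement) : ¬ ¬ GpcZeta4Eq4zeta31 :=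
  fun h2 => h fun _ h2' => absurd h2' h2

/-- Conversely: both sector statements together with a disproof of the summit refute the crux. So a
refutation of the crux is EXACTLY a proof of both open sector cruxes plus a disproof of Conjecture 1 as
formalised. [folklore] -/
theorem not_crux_of_sectors_of_not_summit (h1 : LemniscaticSectorKernel) (h2 : GpcZeta4Eq4zeta31)
    (hs : ¬ KontsevichZagierPeriods) : ¬ SectorComplement :=
  fun h => hs (h h1 h2)

/-- Neither dropped-hypothesis form is refutable short of a disproof of the summit: a refutation of
`H₂ → summit` (the crux without `H₁`) refutes the summit … [folklore] -/
theorem not_summit_of_not_withoutH1 (h : ¬ (GpcZeta4Eq4zeta31 → KontsevichZagierPeriods)) :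
    ¬ KontsevichZagierPeriods := fun hs => h fun _ => hs

/-- … and so does a refutation of `H₁ → summit` (the crux without `H₂`). [folklore] -/
theorem not_summit_of_not_withoutH2 (h : ¬ (LemniscaticSectorKernel → KontsevichZagierPeriods)) :
    ¬ KontsevichZagierPeriods := fun hs => h fun _ => hs

/-! ## §2 The only weapon: a separating additive invariant (template) -/

/-- TEMPLATE of a disproof of the summit: an additive invariant `J` of `FormalRep` vanishing on the four
move sets together with a formal combination of value `0` on which `J` does not vanish. (Soundness,
`relations_le_ker_eval_holds`, says `eval` is such a `J` except for the last clause.) [folklore] -/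
theorem not_summit_of_separating_invariant {A : Type*} [AddCommGroup A] (J : FormalRep →+ A)
    (hJ : ∀ x ∈ domainAddRel ∪ integrandAddRel ∪ changeOfVariablesRel ∪ newtonLeibnizRel, J x = 0)
    (c : FormalRep) (hc : eval c = 0) (hJc : J c ≠ 0) : ¬ KontsevichZagierPeriods := fun h => by
  have hker : relations ≤ J.ker := (AddSubgroup.closure_le _).mpr fun x hx => hJ x hx
  exact hJc (hker ((kzKernelConjecture_iff_isRational.mpr h) c hc))

/-- TEMPLATE of a refutation of the crux: the same invariant PLUS proofs of both sector statements. [folklore] -/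
theorem not_crux_of_separating_invariant {A : Type*} [AddCommGroup A] (J : FormalRep →+ A)
    (hJ : ∀ x ∈ domainAddRel ∪ integrandAddRel ∪ changeOfVariablesRel ∪ newtonLeibnizRel, J x = 0)
    (c : FormalRep) (hc : eval c = 0) (hJc : J c ≠ 0)
    (h1 : LemniscaticSectorKernel) (h2 : GpcZeta4Eq4zeta31) : ¬ SectorComplement :=
  not_crux_of_sectors_of_not_summit h1 h2 (not_summit_of_separating_invariant J hJ c hc hJc)

/-- Conversely every refutation of the summit yields a kernel element outside `relations` (and then the
quotient map by `relations` is a separating invariant). [folklore] -/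
theorem exists_separating_of_not_summit (h : ¬ KontsevichZagierPeriods) :
    ∃ c : FormalRep, eval c = 0 ∧ c ∉ relations := by
  by_contra hc
  push Not at hc
  exact h (kzKernelConjecture_iff_isRational.mp fun c h0 => hc c h0)

/-! ## §3 Refuted strengthening: the value hypothesis of the summit is load-bearing -/

/-- The empty representation has KZ's literal shape (vacuously). [folklore] -/
theorem isRational_empty (n : ℕ) : (IntegralRep.empty n).IsRational :=
  ⟨0, 1, fun _ h => h.elim, fun _ h => h.elim⟩

/-- The empty representation has value `0`. [folklore] -/
theorem value_empty (n : ℕ) : (IntegralRep.empty n).value = 0 := by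
  simp [IntegralRep.value]

/-- `[∅]` and `[ℝ⁰, 1]` are not equivalent (soundness of the calculus: values `0 ≠ 1`). [folklore] -/
theorem not_equivalent_empty_unit : ¬ Equivalent (IntegralRep.empty 0) IntegralRep.unit := fun h => by
  have hv := Equivalent.value_eq_holds h
  rw [value_empty, IntegralRep.value_unit] at hv
  exact zero_ne_one hv

/-- The summit WITHOUT its value hypothesis is false (witness: `[∅]` vs `[ℝ⁰, 1]`, both of KZ's literal
shape). Any proof of the summit must use `r.value = r'.value`. [folklore] -/
theorem not_summitWithoutValueEq :
    ¬ ∀ ⦃n m : ℕ⦄ (r : IntegralRep n) (r' : IntegralRep m), r.IsRational → r'.IsRational → Equivalent r r' :=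
  fun h => not_equivalent_empty_unit (h _ _ (isRational_empty 0) ⟨1, 1, fun _ _ => by simp, fun x _ => by simp⟩)

/-- Hence the crux with that strengthened conclusion fails as soon as the two sector statements hold:
refuting IT is just proving both sectors. [folklore] -/
theorem not_cruxStrong_of_sectors (h1 : LemniscaticSectorKernel) (h2 : GpcZeta4Eq4zeta31) :
    ¬ (LemniscaticSectorKernel → GpcZeta4Eq4zeta31 →
      ∀ ⦃n m : ℕ⦄ (r : IntegralRep n) (r' : IntegralRep m), r.IsRational → r'.IsRational → Equivalent r r') :=
  fun h => not_summitWithoutValueEq (h h1 h2)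

/-! ## §4 Refutations of other summit-consequences transfer to the crux -/

/-- Given the two sectors, a refutation of this route's rank-5 crux 0280 (Legendre's relation in the
calculus) refutes the crux — via the summit (sibling seat, landed:
`not_kontsevichZagierPeriods_of_not_gpcLegendre`). [folklore] -/
theorem not_crux_of_not_gpcLegendre (hneg : ¬ GpcLegendreLemniscatic) (h1 : LemniscaticSectorKernel)
    (h2 : GpcZeta4Eq4zeta31) : ¬ SectorComplement :=
  not_crux_of_sectors_of_not_summit h1 h2
    (Summit.KontsevichZagierPeriods.Grothendieck.GpcLegendreLemniscaticNegative.not_kontsevichZagierPeriods_of_not_gpcLegendre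
      hneg)

end Summit.KontsevichZagierPeriods.SectorComplement.Negative
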